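import Summits.QuantumAdvantage.QuantumAdvantage.Theorems.SparsityDialMP7

/-!
# SparsityDial — part MP8 of 10 of the «MovingPointers» package (decomp-qadv lens 2, g18): §D1–§D2 free window `exists_free_window`, direction vectors, directed line identity, `exists_shift_even_dir`

Imports its predecessor `SparsityDialMP7` (linear chain MP1 → … → MP10); the package overview is the module docstring of `SparsityDialMP1`.
No `sorry`; standard axioms; no instances / notation.
-/

set_option linter.unusedVariables false
set_option linter.dupNamespace false

noncomputable section
open scoped Classical

namespace Summit.QuantumAdvantage.QuantumAdvantage.Theorems.SparsityDial

open Finset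
open Literature.Computability.QuantumComplexity Literature.Computability.QuantumComplexity.RingHLF
open Literature.Computability.MetaComplexity Literature.Computability.MetaComplexity.Smolensky
open Summit.QuantumAdvantage.AdviceFreeQNC0
open Summit.QuantumAdvantage.QuantumAdvantage.Theorems.HolonomyDial (gCond)
open Summit.QuantumAdvantage.QuantumAdvantage.Theorems.LocusDial
open Summit.QuantumAdvantage.QuantumAdvantage.Theorems.AnchorDial (dev outB win_iff card_odd_ge)
open Summit.QuantumAdvantage.QuantumAdvantage.Theorems.HolonomyDial (card_odd_le)
open Summit.QuantumAdvantage.QuantumAdvantage.Theorems.StabilizerDial (eventually_polylog StabFew stabFew_of_fewLocus)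

/-! ## §D1  REV 5 «AffineLookup»: a pointer-FREE WINDOW anywhere suffices — direction vectors -/

section Window
variable {N t : ℕ}

/-- the direction vector of a pointer configuration relative to the window `[w, w+2j)`: `2` for pointers right of the
window, `1` for pointers left of it (the coefficient with which the window's walk increment enters each kernel phase). -/
def dirVec {m : ℕ} (k : Fin m → ℕ) (w j : ℕ) : Fin m → ZMod 3 := fun l => if w + 2 * j ≤ k l then 2 else 1

/-- SparsityDial «MovingPointers» helper `dirVec_ne_zero` (decomp-qadv lens-2 g18 land package; see the module docstring). -/
theorem dirVec_ne_zero {m : ℕ} (k : Fin m → ℕ) (w j : ℕ) (l : Fin m) : dirVec k w j l ≠ 0 := by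
  unfold dirVec; split_ifs <;> decide

/-- **window stretch**: on a pointer-free window `[w, w+2j)` (ending before `N-1`) the occupation profile is the constant
`Σ_l dirVec_l·α_l`. -/
theorem occM_window {m : ℕ} (α : Fin m → ZMod 3) (k : Fin m → ℕ) (w j : ℕ)
    (hT : (∑ l, dirVec k w j l * α l) ≠ 0) (hwin : ∀ l, k l ≤ w ∨ w + 2 * j ≤ k l) (hwN : w + 2 * j + 1 ≤ N) :
    ∃ m₀ : ℕ, m₀ + 2 * j ≤ N ∧ ∀ i, m₀ ≤ i → i + 2 ≤ m₀ + 2 * j → occM N α k i ≠ 0 := by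
  refine ⟨w, by omega, ?_⟩
  intro i hi1 hi2
  have hocc : occM N α k i = ∑ l, dirVec k w j l * α l := by
    unfold occM dirVec
    apply sum_congr rfl
    intro l _
    have h2 : i < N - 1 := by omega
    rw [if_pos h2]
    rcases hwin l with h | h
    · have h1 : ¬ i < k l := by omega
      have h3 : ¬ w + 2 * j ≤ k l := by omega
      rw [if_neg h1, if_neg h3]; ring
    · have h1 : i < k l := by omega
      rw [if_pos h1, if_pos h]; ring
  rw [hocc]; exact hT

/-- SparsityDial «MovingPointers» helper `normSq_appSumM_le_window` (decomp-qadv lens-2 g18 land package; see the module docstring). -/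
theorem normSq_appSumM_le_window (μ' : Fin N → ZMod 3) {m : ℕ} (α : Fin m → ZMod 3) (k : Fin m → ℕ) (w j : ℕ)
    (hT : (∑ l, dirVec k w j l * α l) ≠ 0) (hwin : ∀ l, k l ≤ w ∨ w + 2 * j ≤ k l) (hwN : w + 2 * j + 1 ≤ N) :
    Complex.normSq (∑ x ∈ (univ : Finset (Fin N → Bool)).filter (fun x => OddZeros x),
      χ ((∑ i : Fin N, μ' i * (if x i then 1 else 0)) +
        ∑ l : Fin m, α l * (((Wk x (k l) : ℕ) : ZMod 3) + ((Wk x (N - 1) : ℕ) : ZMod 3)))) ≤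
      4 ^ (N - 2 * j) * 12 ^ j := by
  obtain ⟨m₀, hm₀, hc⟩ := occM_window (N := N) α k w j hT hwin hwN
  have h := normSq_oddSum_le_stretch (N := N) (μA μ') (occM N α k) m₀ j hm₀ hc
  simp_rw [phaseK_appM] at h
  exact h

/-- **window fibre bound**: `432·3^m·3^t·‖fibSumM‖ ≤ 2^N` for every twist with `Σ dirVec·α ≠ 0`. -/
theorem fibSumM_bound_window (M : Fin t → Fin N → ZMod 3) (v : Fin t → ZMod 3) {m : ℕ} (α a : Fin m → ZMod 3)
    (k : Fin m → ℕ) (w j : ℕ) (hT : (∑ l, dirVec k w j l * α l) ≠ 0) (hwin : ∀ l, k l ≤ w ∨ w + 2 * j ≤ k l)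
    (hwN : w + 2 * j + 1 ≤ N) (hjt : 8 * (t + m + 3) + 20 ≤ j) :
    (432 : ℝ) * 3 ^ m * 3 ^ t * ‖fibSumM M v α a k‖ ≤ 2 ^ N := by
  have h2jN : 2 * j ≤ N := by omega
  have hexp := fibSumM_expand M v α a k
  set Z : (Fin t → ZMod 3) → ℂ := fun lam =>
      ∑ x ∈ (univ : Finset (Fin N → Bool)).filter (fun x => OddZeros x),
        χ ((∑ i : Fin N, (∑ s : Fin t, lam s * M s i) * (if x i then 1 else 0)) +
          ∑ l : Fin m, α l * (((Wk x (k l) : ℕ) : ZMod 3) + ((Wk x (N - 1) : ℕ) : ZMod 3))) with hZ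
  have hnorm : (3 : ℝ) ^ t * ‖fibSumM M v α a k‖ ≤ ∑ lam : Fin t → ZMod 3, ‖Z lam‖ := by
    have e3 : ‖(3 : ℂ) ^ t * fibSumM M v α a k‖ = (3 : ℝ) ^ t * ‖fibSumM M v α a k‖ := by
      rw [norm_mul, norm_pow]
      simp
    rw [← e3, hexp]
    refine (norm_sum_le _ _).trans ?_
    apply sum_le_sum
    intro lam _
    rw [norm_mul, norm_χ, mul_one]
  have hper : ∀ lam : Fin t → ZMod 3, (16 : ℝ) * 3 ^ (t + m + 3) * ‖Z lam‖ ≤ 2 ^ N :=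
    fun lam => norm_of_normSq_budget (Z lam) (t + m + 3) N j h2jN hjt
      (normSq_appSumM_le_window (fun i => ∑ s : Fin t, lam s * M s i) α k w j hT hwin hwN)
  have hsum := sum_le_sum (fun lam (_ : lam ∈ (univ : Finset (Fin t → ZMod 3))) => hper lam)
  rw [← mul_sum, sum_const, card_univ, Fintype.card_fun, ZMod.card, Fintype.card_fin, nsmul_eq_mul] at hsum
  push_cast at hsum
  have h3pos : (0 : ℝ) < 3 ^ t := by positivity
  have e27 : (3 : ℝ) ^ (t + m + 3) = 27 * 3 ^ m * 3 ^ t := by rw [pow_add, pow_add]; norm_num; ring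
  rw [e27] at hsum
  have hc : (3 : ℝ) ^ t * ((432 : ℝ) * 3 ^ m * 3 ^ t * ‖fibSumM M v α a k‖) ≤ 3 ^ t * 2 ^ N := by
    have h16 : (0 : ℝ) ≤ 16 * (27 * 3 ^ m * 3 ^ t) := by positivity
    calc (3 : ℝ) ^ t * ((432 : ℝ) * 3 ^ m * 3 ^ t * ‖fibSumM M v α a k‖)
        = 16 * (27 * 3 ^ m * 3 ^ t) * (3 ^ t * ‖fibSumM M v α a k‖) := by ring
      _ ≤ 16 * (27 * 3 ^ m * 3 ^ t) * ∑ lam : Fin t → ZMod 3, ‖Z lam‖ := mul_le_mul_of_nonneg_left hnorm h16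
      _ ≤ 3 ^ t * 2 ^ N := hsum
  exact le_of_mul_le_mul_left hc h3pos

/-- **pigeonhole**: `m` pointers leave one of the `m+1` windows `[2jq, 2j(q+1))`, `q ≤ m`, free. -/
theorem exists_free_window {m : ℕ} (k : Fin m → ℕ) (j : ℕ) (hj : 1 ≤ j) {N : ℕ} (hN : (m + 1) * (2 * j) + 1 ≤ N) :
    ∃ w, w + 2 * j + 1 ≤ N ∧ ∀ l, k l ≤ w ∨ w + 2 * j ≤ k l := by
  have hlt : ((univ : Finset (Fin m)).image (fun l => k l / (2 * j))).card < (range (m + 1)).card := by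
    rw [card_range]
    refine lt_of_le_of_lt card_image_le ?_
    rw [card_univ, Fintype.card_fin]; omega
  obtain ⟨q, hq, hqn⟩ := exists_mem_notMem_of_card_lt_card hlt
  rw [mem_range] at hq
  refine ⟨q * (2 * j), ?_, ?_⟩
  · have h1 : (q + 1) * (2 * j) ≤ (m + 1) * (2 * j) := Nat.mul_le_mul_right _ (by omega)
    have e : q * (2 * j) + 2 * j = (q + 1) * (2 * j) := by ring
    omega
  · intro l
    have hne : k l / (2 * j) ≠ q := by
      intro h
      apply hqn
      rw [mem_image]
      exact ⟨l, mem_univ _, h⟩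
    rcases lt_or_gt_of_ne hne with h | h
    · left
      have := (Nat.div_lt_iff_lt_mul (by omega)).mp h
      omega
    · right
      have h' : q + 1 ≤ k l / (2 * j) := h
      have := (Nat.le_div_iff_mul_le (by omega)).mp h'
      have e : q * (2 * j) + 2 * j = (q + 1) * (2 * j) := by ring
      omega

end Window

/-! ## §D2  Lines in the direction `s = dirVec`: the twists with `Σ s·α = 0` count them; no cell escapes a losing shift -/

section DirLines
variable {N t : ℕ}

/-- SparsityDial «MovingPointers» helper `line_identity_dir` (decomp-qadv lens-2 g18 land package; see the module docstring). -/
theorem line_identity_dir (M : Fin t → Fin N → ZMod 3) (v : Fin t → ZMod 3) {m : ℕ} (s a : Fin m → ZMod 3)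
    (k : Fin m → ℕ) :
    (3 : ℂ) * ∑ α ∈ (univ : Finset (Fin m → ZMod 3)).filter (fun α => ∑ l, s l * α l = 0), fibSumM M v α a k =
      (3 : ℂ) ^ m * ∑ γ : ZMod 3, (((fib M v).filter (fun x => ∀ l, kph x (k l) = a l - γ * s l)).card : ℂ) := by
  have h1 : (3 : ℂ) * ∑ α ∈ (univ : Finset (Fin m → ZMod 3)).filter (fun α => ∑ l, s l * α l = 0), fibSumM M v α a k =
      ∑ α : Fin m → ZMod 3, (∑ γ : ZMod 3, χ (γ * ∑ l, s l * α l)) * fibSumM M v α a k := by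
    rw [mul_sum, sum_filter]
    apply sum_congr rfl
    intro α _
    rw [sum_χ_mul]
    split_ifs <;> simp
  have h2 : ∀ α : Fin m → ZMod 3, (∑ γ : ZMod 3, χ (γ * ∑ l, s l * α l)) * fibSumM M v α a k =
      ∑ γ : ZMod 3, ∑ x ∈ fib M v, χ (∑ l : Fin m, α l * ((kph x (k l) - a l) + γ * s l)) := by
    intro α
    unfold fibSumM
    rw [sum_mul]
    apply sum_congr rfl
    intro γ _
    rw [mul_sum]
    apply sum_congr rfl
    intro x _
    rw [← χ_add]
    congr 1
    rw [mul_sum, ← sum_add_distrib]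
    apply sum_congr rfl
    intro l _
    ring
  have h3 : ∀ (γ : ZMod 3) (x : Fin N → Bool),
      ∑ α : Fin m → ZMod 3, χ (∑ l : Fin m, α l * ((kph x (k l) - a l) + γ * s l)) =
        if (∀ l, kph x (k l) = a l - γ * s l) then (3 : ℂ) ^ m else 0 := by
    intro γ x
    rw [sum_χ_lin m (fun l => (kph x (k l) - a l) + γ * s l)]
    by_cases h : ∀ l, kph x (k l) = a l - γ * s l
    · rw [if_pos h, if_pos]
      funext l
      simp only [Pi.zero_apply]
      rw [h l]; ring
    · rw [if_neg h, if_neg]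
      intro h0
      apply h
      intro l
      have := congrFun h0 l
      simp only [Pi.zero_apply] at this
      linear_combination this
  rw [h1, sum_congr rfl (fun α _ => h2 α), sum_comm, mul_sum]
  apply sum_congr rfl
  intro γ _
  rw [sum_comm, sum_congr rfl (fun x _ => h3 γ x), sum_ite, sum_const_zero, add_zero, sum_const, nsmul_eq_mul]
  ring

/-- **no cell escapes a losing shift (direction `s`, all `s_l ≠ 0`)**: for every phase pattern `b` some shift
`b + γ·s` has an EVEN number of coordinates `≠ 2` — each coordinate is good for exactly two of the three `γ`, so the
three good-counts sum to `2m` and cannot all be odd. -/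
theorem exists_shift_even_dir {m : ℕ} (s : Fin m → ZMod 3) (hs : ∀ l, s l ≠ 0) (b : Fin m → ZMod 3) :
    ∃ γ : ZMod 3, Even ((univ : Finset (Fin m)).filter (fun l => b l + γ * s l ≠ 2)).card := by
  by_contra hne
  push Not at hne
  have two : ∀ l : Fin m, ((univ : Finset (ZMod 3)).filter (fun γ => b l + γ * s l ≠ 2)).card = 2 := by
    intro l
    have key : ∀ bb ss : ZMod 3, ss ≠ 0 →
        ((univ : Finset (ZMod 3)).filter (fun γ => bb + γ * ss ≠ 2)).card = 2 := by decide
    exact key _ _ (hs l)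
  have hdc : ∑ γ : ZMod 3, ((univ : Finset (Fin m)).filter (fun l => b l + γ * s l ≠ 2)).card =
      ∑ l : Fin m, ((univ : Finset (ZMod 3)).filter (fun γ => b l + γ * s l ≠ 2)).card := by
    simp_rw [card_filter]
    rw [sum_comm]
  rw [sum_congr rfl (fun l _ => two l), sum_const, card_univ, Fintype.card_fin, smul_eq_mul] at hdc
  choose p hp using fun γ : ZMod 3 => Nat.not_even_iff_odd.mp (hne γ)
  have hodd : ∑ γ : ZMod 3, ((univ : Finset (Fin m)).filter (fun l => b l + γ * s l ≠ 2)).card =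
      2 * (∑ γ : ZMod 3, p γ) + 3 := by
    rw [sum_congr rfl (fun γ _ => hp γ), sum_add_distrib, ← mul_sum, sum_const, card_univ, ZMod.card, smul_eq_mul,
      mul_one]
  omega

/-- **covering in direction `s`**. -/
theorem cover_sum_le_dir {m : ℕ} (s : Fin m → ZMod 3) (hs : ∀ l, s l ≠ 0) (E : (Fin m → ZMod 3) → ℝ)
    (hE : ∀ b, 0 ≤ E b) :
    ∑ b : Fin m → ZMod 3, E b ≤ ∑ a ∈ evenCells m, ∑ γ : ZMod 3, E (fun l => a l - γ * s l) := by
  choose g hg using fun b : Fin m → ZMod 3 => exists_shift_even_dir s hs b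
  set ι : (Fin m → ZMod 3) → (Fin m → ZMod 3) × ZMod 3 := fun b => (fun l => b l + g b * s l, g b) with hι
  set G : (Fin m → ZMod 3) × ZMod 3 → ℝ := fun p => E (fun l => p.1 l - p.2 * s l) with hGdef
  have hinj : Function.Injective ι := by
    intro b b' h
    simp only [hι, Prod.mk.injEq] at h
    obtain ⟨h1, h2⟩ := h
    funext l
    have := congrFun h1 l
    rw [h2] at this
    exact add_right_cancel this
  have hG : ∀ b, E b = G (ι b) := by
    intro b
    simp only [hι, hGdef, add_sub_cancel_right]
  have himg : univ.image ι ⊆ evenCells m ×ˢ (univ : Finset (ZMod 3)) := by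
    intro p hp
    rw [mem_image] at hp
    obtain ⟨b, _, rfl⟩ := hp
    rw [mem_product]
    refine ⟨?_, mem_univ _⟩
    unfold evenCells
    rw [mem_filter]
    exact ⟨mem_univ _, hg b⟩
  have hGnn : ∀ p, 0 ≤ G p := fun p => hE _
  calc ∑ b : Fin m → ZMod 3, E b = ∑ b : Fin m → ZMod 3, G (ι b) := sum_congr rfl (fun b _ => hG b)
    _ = ∑ p ∈ univ.image ι, G p := (sum_image (fun b _ b' _ h => hinj h)).symm
    _ ≤ ∑ p ∈ evenCells m ×ˢ (univ : Finset (ZMod 3)), G p :=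
        sum_le_sum_of_subset_of_nonneg himg (fun p _ _ => hGnn p)
    _ = ∑ a ∈ evenCells m, ∑ γ : ZMod 3, E (fun l => a l - γ * s l) := by
        rw [sum_product]

/-- **line-to-cell estimate in direction `s`**. -/
theorem line_le_cell_dir (M : Fin t → Fin N → ZMod 3) (v : Fin t → ZMod 3) {m : ℕ} (s a : Fin m → ZMod 3)
    (k : Fin m → ℕ) (B : ℝ) (hB0 : 0 ≤ B)
    (hB : ∀ α : Fin m → ZMod 3, (∑ l, s l * α l) ≠ 0 → ‖fibSumM M v α a k‖ ≤ B) :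
    (∑ γ : ZMod 3, (((fib M v).filter (fun x => ∀ l, kph x (k l) = a l - γ * s l)).card : ℝ)) ≤
      3 * ((fib M v).filter (fun x => ∀ l, kph x (k l) = a l)).card + 3 * B := by
  have hc := cellM_count M v a k
  push_cast at hc
  have hl := line_identity_dir M v s a k
  set F : (Fin m → ZMod 3) → ℂ := fun α => fibSumM M v α a k with hF
  set Zc := (univ : Finset (Fin m → ZMod 3)).filter (fun α => ¬ (∑ l, s l * α l = 0)) with hZc
  have hsplit : ∑ α : Fin m → ZMod 3, F α =
      (∑ α ∈ (univ : Finset (Fin m → ZMod 3)).filter (fun α => ∑ l, s l * α l = 0), F α) + ∑ α ∈ Zc, F α :=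
    (sum_filter_add_sum_filter_not univ (fun α : Fin m → ZMod 3 => ∑ l, s l * α l = 0) F).symm
  have hZc_card : (Zc.card : ℝ) ≤ 3 ^ m := by
    have h1 : Zc.card ≤ (univ : Finset (Fin m → ZMod 3)).card := card_filter_le _ _
    rw [card_univ, Fintype.card_fun, ZMod.card, Fintype.card_fin] at h1
    exact_mod_cast h1
  have hrest : ‖∑ α ∈ Zc, F α‖ ≤ 3 ^ m * B := by
    refine (norm_sum_le _ _).trans ?_
    have hle : ∀ α ∈ Zc, ‖F α‖ ≤ B := by
      intro α hα
      rw [hZc, mem_filter] at hα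
      exact hB α hα.2
    have := sum_le_sum hle
    rw [sum_const, nsmul_eq_mul] at this
    nlinarith [this, hZc_card]
  have e : (((3 ^ m * ∑ γ : ZMod 3, ((fib M v).filter (fun x => ∀ l, kph x (k l) = a l - γ * s l)).card : ℕ)) : ℂ) =
      (((3 * (3 ^ m * ((fib M v).filter (fun x => ∀ l, kph x (k l) = a l)).card) : ℕ)) : ℂ) - 3 * ∑ α ∈ Zc, F α := by
    push_cast
    rw [← hl, hc, hsplit]
    ring
  have hn : ‖(((3 ^ m * ∑ γ : ZMod 3, ((fib M v).filter (fun x => ∀ l, kph x (k l) = a l - γ * s l)).card : ℕ)) : ℂ)‖ ≤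
      ‖(((3 * (3 ^ m * ((fib M v).filter (fun x => ∀ l, kph x (k l) = a l)).card) : ℕ)) : ℂ)‖ +
        ‖(3 : ℂ) * ∑ α ∈ Zc, F α‖ := by
    rw [e]; exact norm_sub_le _ _
  rw [Complex.norm_natCast, Complex.norm_natCast] at hn
  push_cast at hn
  have h3 : ‖(3 : ℂ)‖ = 3 := by
    have := Complex.norm_natCast 3
    push_cast at this
    exact this
  have hR : ‖(3 : ℂ) * ∑ α ∈ Zc, F α‖ ≤ 3 * (3 ^ m * B) := by
    rw [norm_mul, h3]; nlinarith [hrest]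
  have h3m : (0 : ℝ) < 3 ^ m := by positivity
  have key : (3 : ℝ) ^ m * (∑ γ : ZMod 3, (((fib M v).filter (fun x => ∀ l, kph x (k l) = a l - γ * s l)).card : ℝ)) ≤
      3 ^ m * (3 * ((fib M v).filter (fun x => ∀ l, kph x (k l) = a l)).card + 3 * B) := by
    nlinarith [hn, hR]
  exact le_of_mul_le_mul_left key h3m

end DirLines


end Summit.QuantumAdvantage.QuantumAdvantage.Theorems.SparsityDial
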